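import Summits.HubbardSuperconductivity.HubbardSuperconductivity.Theorems.ThermalWedgeTwSourcedInertnessReduction
import Literature.MathematicalPhysics.QuantumLattice.GibbsEntropy
import Literature.MathematicalPhysics.QuantumLattice.GibbsPressureTemperature
import Literature.MathematicalPhysics.QuantumLattice.DWaveSourceProofs

/-!
# Route `ThermalWedge`, crux `TwSourcedCondensation` (item `stmt-HubbardSuperconductivity-1697`), line
# `entropy-staircase-linear-regime`, stub (T') `stub_deepThermalSlack`: the bridge from the sourced
# interacting entropy-density law

Registered sub-goal `stub_deepThermalSlack_of_sourcedEntropyDensityLaw` (skeleton v4 of the line,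
`Cruxes/TwSourcedCondensation/Lines/entropy_staircase_linear_regime.lean`). It kernel-checks WHICH
missing fact discharges the thermal stub (T'): the SOURCED interacting entropy-density law in `∀ η`
form on the closed thermal disc `|h| ≤ 1/β`,

  `S_β(dWaveSourceTorus L U μ h) ≤ (η log β + K) L²/β`   (`0 < U ≤ U₀`, `1 ≤ β ≤ e^{a/U}`, eventually in `L`),

implies (T') verbatim (constant `K' = 2K`, `U₀ ← min U₀ (1/16)` so that the diagonal-deep window
`1/(4β²) < h² < U ≤ 1/16` forces `β > 2`): the interacting chord is `≤ S_U(β/2,h)/(βL²)`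
(`pressure_sub_pressure_le_gibbsEntropy`) and the free chord is `≥ 0` (`log_partitionFn_div_antitone`),
exactly as in the tree's `stub_thermalCorrection_of_entropyDensityLaw` (crux 1696, `h = 0`, `∃ C`).
Conversely the dyadic sandwich `S_β ≤ βL²·chord(β) ≤ S_{β/2}` (`GibbsEntropy`) and the free thermal law
(p78799) make (T') equivalent, up to constants and on its window, to this law on the diagonal; so the
law is the minimal missing input of (T') — an interacting Fermi-liquid specific-heat statement at
`T ≥ e^{-a/U}`, general filling, with source: one-cutoff multiscale expansion, not in print
(Benfatto–Giuliani–Mastropietro, AHP 7 (2006) 809, Thm 1.1 is `h = 0`, low density, two-point only).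

Tree search record (2026-08-16): no PROVED interacting thermal statement at `T ≥ e^{-a/U}` exists —
every heat-chord / entropy-density law of the interacting torus in the tree is a `sorry` stub
(crux 1696: `stub_thermalCorrection`, `stub_entropyDensity_of_counting`) or a HYPOTHESIS of a proved
bridge (`stub_thermalCorrection_of_entropyDensityLaw`, `twSourcedInertness_of_corrections`,
`…OfFermiLiquidLaws`); `bgm_two_point_limit` is an unproved `def` (two-point, `h = 0`, `μ < −2−√2`).
No definition, no named fact.
-/

noncomputable section

namespace Summit.HubbardSuperconductivity.HubbardSuperconductivity.Theorems

open Matrix Finset Literature.MathematicalPhysics.QuantumLattice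

/-- **(T') from the sourced interacting entropy-density law (`∀ η` form)**: the law on the disc `|h| ≤ 1/β`
applied at `β/2`, the chord–entropy inequality `p̃(β/2) − p̃(β) ≤ S_{β/2}/(βL²)` for the interacting torus
and antitonicity of `β ↦ β⁻¹ log Z` for the free one. [folklore] -/
theorem stub_deepThermalSlack_of_sourcedEntropyDensityLaw :
    (∀ μ₁ μ₂ : ℝ, -4 < μ₁ → μ₁ ≤ μ₂ → μ₂ < 0 → ∀ η : ℝ, 0 < η → ∃ U₀ a K : ℝ, 0 < U₀ ∧ 0 < a ∧
      0 < K ∧ ∀ U : ℝ, 0 < U → U ≤ U₀ → ∀ β : ℝ, 1 ≤ β → β ≤ Real.exp (a / U) →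
      ∀ μ ∈ Set.Icc μ₁ μ₂, ∃ L₀ : ℕ, ∀ (L : ℕ) [NeZero L], L₀ ≤ L → ∀ h : ℝ, |h| ≤ 1 / β →
      Matrix.gibbsEntropy β (Literature.MathematicalPhysics.QuantumLattice.dWaveSourceTorus L U μ h) ≤
        (η * Real.log β + K) * (L : ℝ) ^ 2 / β) →
    ∀ μ₁ μ₂ : ℝ, -4 < μ₁ → μ₁ ≤ μ₂ → μ₂ < 0 → ∀ η : ℝ, 0 < η → ∃ U₀ a K' : ℝ, 0 < U₀ ∧ 0 < a ∧ 0 <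
      K' ∧ ∀ U : ℝ, 0 < U → U ≤ U₀ → ∀ β : ℝ, 1 ≤ β → β ≤ Real.exp (a / U) → ∀ μ ∈ Set.Icc μ₁ μ₂, ∃ L₀
      : ℕ, ∀ (L : ℕ) [NeZero L], L₀ ≤ L → ∀ h : ℝ, |h| ≤ 1 / β → 1 < |h| * (2 * β) → h ^ 2 < U →
      (Real.log (Matrix.partitionFn (β / 2)
      (Literature.MathematicalPhysics.QuantumLattice.dWaveSourceTorus L U μ h)).re / (β / 2 * (L : ℝ)
      ^ 2) - Real.log (Matrix.partitionFn β
      (Literature.MathematicalPhysics.QuantumLattice.dWaveSourceTorus L U μ h)).re / (β * (L : ℝ) ^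
      2)) - (Real.log (Matrix.partitionFn (β / 2)
      (Literature.MathematicalPhysics.QuantumLattice.dWaveSourceTorus L 0 μ h)).re / (β / 2 * (L : ℝ)
      ^ 2) - Real.log (Matrix.partitionFn β
      (Literature.MathematicalPhysics.QuantumLattice.dWaveSourceTorus L 0 μ h)).re / (β * (L : ℝ) ^
      2)) ≤ (η * Real.log β + K') / β ^ 2 := by
  intro hS μ₁ μ₂ h4 h12 h0 η hη
  obtain ⟨U₀, a, K, hU₀, ha, hK, hmain⟩ := hS μ₁ μ₂ h4 h12 h0 (η / 2) (half_pos hη)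
  refine ⟨min U₀ (1 / 16), a, 2 * K, lt_min hU₀ (by norm_num), ha, by positivity, ?_⟩
  intro U hU hUle β hβ hβB μ hμ
  have hUU₀ : U ≤ U₀ := hUle.trans (min_le_left _ _)
  have hU16 : U ≤ 1 / 16 := hUle.trans (min_le_right _ _)
  have hβ0 : 0 < β := by linarith
  by_cases hβ2 : 2 ≤ β
  · -- the entropy law at `β/2`
    have hb1 : 1 ≤ β / 2 := by linarith
    have hbB : β / 2 ≤ Real.exp (a / U) := by linarith
    obtain ⟨L₀, hL₀⟩ := hmain U hU hUU₀ (β / 2) hb1 hbB μ hμ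
    refine ⟨L₀, fun L _ hL h hh _ _ => ?_⟩
    have hL2 : (0 : ℝ) < (L : ℝ) ^ 2 := cast_sq_pos_of_neZero L
    have hHU := isHermitian_dWaveSourceTorus L U μ h
    have hH0 := isHermitian_dWaveSourceTorus L 0 μ h
    -- interacting chord ≤ S_U(β/2,h)/(β L²)
    have h1 := hHU.pressure_sub_pressure_le_gibbsEntropy hβ0 (half_pos hβ0)
    have hfac : (β - β / 2) / (β * (β / 2)) = 1 / β := by
      field_simp
      ring
    rw [hfac] at h1
    have h1' := div_le_div_of_nonneg_right h1 hL2.le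
    rw [sub_div, div_div, div_div] at h1'
    -- free chord ≥ 0
    have h2 := log_partitionFn_div_antitone hH0 (half_pos hβ0) (by linarith : β / 2 ≤ β)
    have h2' := div_le_div_of_nonneg_right h2 hL2.le
    rw [div_div, div_div] at h2'
    -- the entropy bound at β/2 (source admissible: |h| ≤ 1/β ≤ 1/(β/2))
    have hh' : |h| ≤ 1 / (β / 2) := by
      refine hh.trans ?_
      rw [div_le_div_iff₀ hβ0 (half_pos hβ0)]
      linarith
    have hS' := hL₀ L hL h hh'
    have hlog : Real.log (β / 2) ≤ Real.log β := Real.log_le_log (by positivity) (by linarith)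
    have hlog0 : 0 ≤ Real.log (β / 2) := Real.log_nonneg hb1
    have hSle : gibbsEntropy (β / 2) (dWaveSourceTorus L U μ h) ≤
        (η / 2 * Real.log β + K) * (L : ℝ) ^ 2 / (β / 2) := by
      refine hS'.trans ?_
      apply div_le_div_of_nonneg_right _ (by positivity)
      apply mul_le_mul_of_nonneg_right _ hL2.le
      nlinarith
    have hSbound : 1 / β * gibbsEntropy (β / 2) (dWaveSourceTorus L U μ h) / (L : ℝ) ^ 2 ≤
        (η * Real.log β + 2 * K) / β ^ 2 := by
      calc 1 / β * gibbsEntropy (β / 2) (dWaveSourceTorus L U μ h) / (L : ℝ) ^ 2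
          ≤ 1 / β * ((η / 2 * Real.log β + K) * (L : ℝ) ^ 2 / (β / 2)) / (L : ℝ) ^ 2 := by gcongr
        _ = (η * Real.log β + 2 * K) / β ^ 2 := by
            have hL0 : (L : ℝ) ≠ 0 := by
              intro hz
              rw [hz] at hL2
              simp at hL2
            field_simp
    linarith [h1', h2', hSbound]
  · -- `β < 2`: the diagonal-deep window is empty since `U ≤ 1/16`
    refine ⟨0, fun L _ _ h hh hdiag hdeep => ?_⟩
    exfalso
    have hβ2 : β < 2 := lt_of_not_ge hβ2
    -- |h| > 1/(2β) > 1/4 but h² < U ≤ 1/16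
    have hpos : 0 < |h| * (2 * β) := by linarith
    have habs : 1 / 4 < |h| := by
      by_contra hcon
      have hcon : |h| ≤ 1 / 4 := le_of_not_gt hcon
      have : |h| * (2 * β) ≤ 1 / 4 * (2 * β) := by
        apply mul_le_mul_of_nonneg_right hcon (by linarith)
      nlinarith
    have hsq : (1 / 4 : ℝ) ^ 2 < |h| ^ 2 := by
      exact pow_lt_pow_left₀ habs (by norm_num) two_ne_zero
    rw [sq_abs] at hsq
    linarith

end Summit.HubbardSuperconductivity.HubbardSuperconductivity.Theorems
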